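import Literature.AlgebraicGeometry.HodgeTheory.CMFieldOneScalarPlaceHodgeLie
import Literature.AlgebraicGeometry.Motives.HodgeStructureEndAlgSemisimple
import HarnessLib

/-!
# The no-Weil-type condition: from `β ∈ End(A)`, `β² = −d`, `mult(i√d) ≠ mult(−i√d)` on `H^{1,0}(A)` to the
# trace form `Tr(y_ℂ Θ) ≠ 0` for Rosati-skew Hodge endomorphisms `y` with `y² ∈ ℚ·1` (Moonen–Zarhin 1999 (2.3);
# van Geemen 1994 §2.4; Mumford §21)

Family `hodge`, layer `Literature/AlgebraicGeometry/HodgeTheory` (brick P5(γ), the GEOMETRIC DICTIONARY of the design note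
`HOME/jobs/A7-inventory-eng5g6/DESIGN-rows10-12-allmembers.md` of the cell `pub-hodgeav-hg6`, req-37 (A) Q2b, TABLE X row 12
members of CM pattern `(2,2,1)`). UNCONDITIONAL; theorems only, no definition, no named fact, no `sorry`. HONEST FRAMING of
that cell: HC / HC_AV / HC_CM / H2 NOT proved — this file only translates the displayed hypothesis `hnoWeil` of the tree's
`AbelianVariety.hodgeLieC_of_cmField_oneBalancedPlace` (Hodge form: for the Hodge operator `Θ` of `H¹(A(ℂ); ℂ)` every
non-zero Rosati-skew Hodge endomorphism `y` of `H¹(A(ℂ); ℚ)` with `y² ∈ ℚ·1` has `Tr(y_ℂ Θ) ≠ 0`) into the geometric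
no-Weil-type condition of the census rows («for every `β ∈ End(A)` and `d > 0` with `β ∘ β = −d`, the multiplicities of
`i√d` and `−i√d` on `H^{1,0}(A)` differ», i.e. `A` is not of Weil type relative to any imaginary quadratic `ℚ(β) ⊂ End⁰(A)`).

* §1 (linear algebra of a weight-one Hodge structure) `CMArith.isCompl_eigenspace_of_mul_self` (`T² = s² ≠ 0`:
  `V = W_s ⊕ W_{−s}`), **`CMArith.trace_mul_theta_of_mul_self`** (`Tr(T Θ) = s·((dim W_s^{1,0} − dim W_s^{0,1}) −
  (dim W_{−s}^{1,0} − dim W_{−s}^{0,1}))` for `T` commuting with the Hodge operator `Θ`, `T² = s²`, `s ≠ 0`),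
  `CMArith.lt_zero_of_skew_of_mul_self` (a non-zero `ψ`-skew Hodge endomorphism with `y² = q·1` has `q < 0`: positivity of
  the Rosati involution, `Tr(y† y) > 0`).
* §2 (abelian varieties) **`AbelianVariety.trace_mul_theta_ne_zero_of_noWeilType`** — the dictionary: the geometric
  no-Weil-type condition implies the Hodge-form `hnoWeil` (reverse transport `y = c·F^*`, `F ∈ End(A)`, by Riemann's
  theorem `End_Hdg(H¹) = End⁰(A)` — tree `mem_endAlg_hodge_one_iff_exists_bettiRep` — and faithfulness of `F ↦ F^*`,
  tree `bettiRep₀_injective`; then §1 with `T = β^*_ℂ`, `s = i√d`, and the tree's multiplicity dictionary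
  `finrank_eigenspace_inf_piece_oneZero_eq_eigenMultiplicity`).

## References
* [MoonenZarhin1999LowDim] B. Moonen, Yu. Zarhin, Math. Ann. 315 (1999), §2 (2.3), (1.8) (Weil type, `Hg ⊆ SU`).
* [vanGeemen1994HodgeAV] B. van Geemen, in: Barth, Hulek, Lange (eds.), de Gruyter 1994, §2.4 (abelian varieties of Weil
  type: `k ⊂ End⁰(A)` acting with multiplicities `(n, n)` on `T_0 A`), Lemma 3.7.
* [MumfordAV1970] D. Mumford, Abelian Varieties (1970), §21 (positivity of the Rosati involution), §19.
* [LangeBirkenhake1992] H. Lange, Ch. Birkenhake, Complex Abelian Varieties (1992), §1.1 (the rational representation is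
  faithful).
* [Deligne1982HodgeCycles] P. Deligne, Hodge cycles on abelian varieties, LNM 900 (1982), §4 (p. 30).
-/

open scoped TensorProduct
open CategoryTheory Module

universe u

namespace Literature.AlgebraicGeometry.Motives

namespace HodgeStructure

variable {V : Type u} [AddCommGroup V] [Module ℚ V] {n : ℤ}

/-! ## §1 Linear algebra: `T² = s²`, the trace of `T Θ`, the sign of `y²` -/

/-- **`V = W_s ⊕ W_{−s}` for an operator `T` with `T² = s²` (pointwise), `s ≠ 0`** (`W_t = ker(T − t)`;
`v = (2s)⁻¹(s v + T v) + (2s)⁻¹(s v − T v)`). [cite: Deligne1982HodgeCycles, §4 (p. 30)] -/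
theorem CMArith.isCompl_eigenspace_of_mul_self {M : Type*} [AddCommGroup M] [Module ℂ M] {T : Module.End ℂ M} {s : ℂ}
    (hs : s ≠ 0) (hTT : ∀ w, T (T w) = (s * s) • w) :
    IsCompl (Module.End.eigenspace T s) (Module.End.eigenspace T (-s)) := by
  have h2s : (2 * s) ≠ 0 := mul_ne_zero two_ne_zero hs
  refine ⟨Submodule.disjoint_def.2 fun x hx hx' => ?_, codisjoint_iff.2 (Submodule.eq_top_iff'.2 fun v => ?_)⟩
  · rw [Module.End.mem_eigenspace_iff] at hx hx'
    have h : (s - -s) • x = 0 := by rw [sub_smul, ← hx, ← hx', sub_self]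
    rw [sub_neg_eq_add, ← two_mul] at h
    exact (smul_eq_zero.1 h).resolve_left h2s
  · refine Submodule.mem_sup.2 ⟨(2 * s)⁻¹ • (s • v + T v), ?_, (2 * s)⁻¹ • (s • v - T v), ?_, ?_⟩
    · rw [Module.End.mem_eigenspace_iff, map_smul, map_add, map_smul, hTT]
      module
    · rw [Module.End.mem_eigenspace_iff, map_smul, map_sub, map_smul, hTT]
      module
    · rw [← smul_add, add_add_sub_cancel, ← two_smul ℂ (s • v), smul_smul, smul_smul,
        show (2 * s)⁻¹ * 2 * s = 1 by rw [mul_assoc, inv_mul_cancel₀ h2s], one_smul]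

/-- **`Tr(T Θ) = s·((dim W_s^{1,0} − dim W_s^{0,1}) − (dim W_{−s}^{1,0} − dim W_{−s}^{0,1}))`** for the Hodge operator `Θ`
(`= +1` on `V^{1,0}`, `−1` on `V^{0,1}`) of an effective weight-one Hodge structure and an operator `T` of `V_ℂ` commuting
with `Θ` with `T² = s²`, `s ≠ 0`: `V_ℂ = W_s ⊕ W_{−s}` is `Θ`-stable, `T Θ = ±s Θ` on the blocks, and `tr(Θ|_W) =
dim W^{1,0} − dim W^{0,1}` (`CMArith.trace_restrict_theta`). [cite: Deligne1982HodgeCycles, §4 (p. 30)]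
[cite: MoonenZarhin1999LowDim, §2 (2.3)] -/
theorem CMArith.trace_mul_theta_of_mul_self [Module.Finite ℚ V] (H : HodgeStructure V n) (hn : n = 1)
    (heff : H.IsEffective) {Θ : Module.End ℂ (ℂ ⊗[ℚ] V)}
    (hΘ : ∀ p, ∀ x ∈ H.piece p (n - p), Θ x = ((2 * p - n : ℤ) : ℂ) • x)
    {T : Module.End ℂ (ℂ ⊗[ℚ] V)} (hΘT : Θ * T = T * Θ) {s : ℂ} (hs : s ≠ 0) (hTT : ∀ w, T (T w) = (s * s) • w) :
    LinearMap.trace ℂ _ (T * Θ) =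
      s * (((Module.finrank ℂ ↥(Module.End.eigenspace T s ⊓ H.piece 1 0) : ℂ) -
          Module.finrank ℂ ↥(Module.End.eigenspace T s ⊓ H.piece 0 1)) -
        ((Module.finrank ℂ ↥(Module.End.eigenspace T (-s) ⊓ H.piece 1 0) : ℂ) -
          Module.finrank ℂ ↥(Module.End.eigenspace T (-s) ⊓ H.piece 0 1))) := by
  classical
  have hΘW : ∀ c, ∀ w ∈ Module.End.eigenspace T c, Θ w ∈ Module.End.eigenspace T c :=
    fun c w hw => UnitaryTheta.apply_mem_eigenspace_of_commute hΘT hw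
  have hTW : ∀ c, ∀ w ∈ Module.End.eigenspace T c, T w ∈ Module.End.eigenspace T c :=
    fun c w hw => UnitaryTheta.apply_mem_eigenspace_of_commute rfl hw
  have hblock : ∀ (c : ℂ) (hc : Set.MapsTo (T * Θ) (Module.End.eigenspace T c) (Module.End.eigenspace T c)),
      LinearMap.trace ℂ ↥(Module.End.eigenspace T c) ((T * Θ).restrict hc) =
        c * ((Module.finrank ℂ ↥(Module.End.eigenspace T c ⊓ H.piece 1 0) : ℂ) -
          Module.finrank ℂ ↥(Module.End.eigenspace T c ⊓ H.piece 0 1)) := by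
    intro c hc
    have hrestr : (T * Θ).restrict hc = c • Θ.restrict (hΘW c) := by
      refine LinearMap.ext fun w => Subtype.ext ?_
      rw [LinearMap.coe_restrict_apply, LinearMap.smul_apply, Submodule.coe_smul, LinearMap.coe_restrict_apply,
        Module.End.mul_apply]
      exact Module.End.mem_eigenspace_iff.1 (hΘW c w w.2)
    rw [hrestr, map_smul, CMArith.trace_restrict_theta H hn heff hΘ (hΘW c), smul_eq_mul]
  let N : Bool → Submodule ℂ (ℂ ⊗[ℚ] V) := fun b =>
    bif b then Module.End.eigenspace T s else Module.End.eigenspace T (-s)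
  have hint : DirectSum.IsInternal N :=
    (DirectSum.isInternal_submodule_iff_isCompl N (i := true) (j := false) (by decide)
      (Set.ext fun b => by cases b <;> simp)).2 (CMArith.isCompl_eigenspace_of_mul_self hs hTT)
  have hf : ∀ b, Set.MapsTo (T * Θ) (N b) (N b) := by
    intro b
    cases b
    · show Set.MapsTo (T * Θ) (Module.End.eigenspace T (-s)) (Module.End.eigenspace T (-s))
      exact fun w hw => hTW _ _ (hΘW _ _ hw)
    · show Set.MapsTo (T * Θ) (Module.End.eigenspace T s) (Module.End.eigenspace T s)
      exact fun w hw => hTW _ _ (hΘW _ _ hw)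
  rw [LinearMap.trace_eq_sum_trace_restrict hint hf, Fintype.sum_bool]
  show LinearMap.trace ℂ ↥(Module.End.eigenspace T s) ((T * Θ).restrict (hf true)) +
      LinearMap.trace ℂ ↥(Module.End.eigenspace T (-s)) ((T * Θ).restrict (hf false)) = _
  rw [hblock s (hf true), hblock (-s) (hf false)]
  ring

/-- **A non-zero `ψ`-skew Hodge endomorphism `y` with `y² = q·1` has `q < 0`** (positivity of the Rosati involution:
`y† = −y` and `0 < Tr(y† y) = −q·dim V`). [cite: MumfordAV1970, §21] [cite: Deligne1982HodgeCycles, §4 (p. 30)] -/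
theorem CMArith.lt_zero_of_skew_of_mul_self [Module.Finite ℚ V] (H : HodgeStructure V n) (ψ : H.Polarization)
    {y : Module.End ℚ V} (hy : y ∈ H.endAlg) (hy0 : y ≠ 0)
    (hskew : ∀ v w, ψ.form (y v) w + ψ.form v (y w) = 0) {q : ℚ} (hq : y * y = q • 1) : q < 0 := by
  have hadj : ψ.adjoint y = -y :=
    (ψ.eq_adjoint_of_isAdjointPair (a := y) (b := -y) fun v w => by
      rw [LinearMap.neg_apply, map_neg]; linarith [hskew v w]).symm
  have hpos := ψ.trace_adjoint_mul_self_pos hy hy0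
  rw [hadj, neg_mul, hq, map_neg, map_smul, LinearMap.trace_one, smul_eq_mul] at hpos
  have hV : (0 : ℚ) ≤ Module.finrank ℚ V := Nat.cast_nonneg _
  nlinarith

end HodgeStructure

end Literature.AlgebraicGeometry.Motives

namespace Literature.AlgebraicGeometry.HodgeTheory

open Literature.AlgebraicTopology.SingularHomology
open Literature.AlgebraicGeometry.Motives (IsSmoothProjective AbelianVariety bettiCohomology HodgeTensorFacts
  hodgeTensorFacts_holds)
open Literature.AlgebraicGeometry.Motives.HodgeStructure
open Literature.AlgebraicGeometry.ComplexMultiplication (bettiRep bettiRep_of bettiRep₀ bettiRep₀_apply bettiRep₀_injective)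

/-! ## §2 Abelian varieties: the geometric no-Weil-type condition gives the Hodge-form `hnoWeil` -/

/-- Faithfulness of the rational representation, in the shape used below: if `β^* ∘ β^* = −d` on `H¹(A(ℂ); ℚ)` then
`β ∘ β = −d` in `End(A)`. [cite: LangeBirkenhake1992, §1.1 (the rational representation ρ_r is injective)] -/
private theorem comp_self_eq_neg_nsmul_id {A : AbelianVariety ℂ} (β : A ⟶ A) (d : ℕ)
    (h : (bettiCohomology.map β.hom.hom.hom 1).hom * (bettiCohomology.map β.hom.hom.hom 1).hom =
      -((d : ℚ) • (1 : Module.End ℚ (bettiCohomology A.X 1)))) :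
    β ≫ β = -(d • 𝟙 A) := by
  rw [Nat.cast_smul_eq_nsmul] at h
  have key : CategoryTheory.End.of β * CategoryTheory.End.of β = -(d • (1 : CategoryTheory.End A)) := by
    apply bettiRep₀_injective (A := A)
    apply MulOpposite.unop_injective
    rw [map_mul, map_neg, map_nsmul, map_one, MulOpposite.unop_mul, bettiRep₀_apply, MulOpposite.unop_op,
      MulOpposite.unop_neg, MulOpposite.unop_smul, MulOpposite.unop_one]
    exact h
  exact key

/-- **THE NO-WEIL-TYPE DICTIONARY.** For a complex abelian variety `A` satisfying the geometric no-Weil-type condition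
«for every `d > 0` and `β ∈ End(A)` with `β ∘ β = −d`, `mult_{H^{1,0}}(β, i√d) ≠ mult_{H^{1,0}}(β, −i√d)`» (i.e. `A` is
not of Weil type relative to any imaginary quadratic `ℚ(β) ⊂ End⁰(A)`, van Geemen §2.4), every non-zero `ψ`-skew Hodge
endomorphism `y` of `H¹(A(ℂ); ℚ)` with `y² = q·1`, `q ∈ ℚ`, has `Tr(y_ℂ Θ) ≠ 0` for the Hodge operator `Θ` — the
hypothesis `hnoWeil` of the tree's `AbelianVariety.hodgeLieC_of_cmField_oneBalancedPlace`. Proof: `q < 0` (Rosati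
positivity); `y = c·F^*` with `F ∈ End(A)` (Riemann: `End_Hdg(H¹) = End⁰(A)`); `β = den(r)·F` with `r = q/c²` has
`β^*² = −d`, `d = den(r)·|num(r)| > 0`, so `β ∘ β = −d` (faithfulness); `Tr(β^*_ℂ Θ) = 2 i√d (mult(i√d) − mult(−i√d))`
(§1 and the multiplicity dictionary, `dim W_{i√d}^{0,1} = mult(−i√d)`), and `β^* = (den(r)/c)·y`.
[cite: MoonenZarhin1999LowDim, §2 (2.3)] [cite: vanGeemen1994HodgeAV, §2.4] [cite: MumfordAV1970, §21]
[cite: LangeBirkenhake1992, §1.1 (the rational representation ρ_r is injective)] -/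
theorem AbelianVariety.trace_mul_theta_ne_zero_of_noWeilType [HodgeTensorFacts.{0, 0}] (A : AbelianVariety ℂ)
    (hHD : exists_isReal_hodgeModel) (hI : hodgePQ_independent_of_hodgeModel)
    (ψ : (BettiUniverse.hodge hHD (AbelianVariety.isSmoothProjective_holds (A := A)) 1).Polarization)
    (hnW : ∀ (d : ℕ) (β : A ⟶ A), 0 < d → β ≫ β = -(d • 𝟙 A) →
      eigenMultiplicity A β (Complex.I * (Real.sqrt d : ℂ)) ≠ eigenMultiplicity A β (-(Complex.I * (Real.sqrt d : ℂ)))) :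
    ∀ Θ : Module.End ℂ (ℂ ⊗[ℚ] bettiCohomology A.X 1),
      (∀ p, ∀ x ∈ (BettiUniverse.hodge hHD (AbelianVariety.isSmoothProjective_holds (A := A)) 1).piece p (1 - p),
        Θ x = ((2 * p - 1 : ℤ) : ℂ) • x) →
      ∀ y ∈ (BettiUniverse.hodge hHD (AbelianVariety.isSmoothProjective_holds (A := A)) 1).endAlg, y ≠ 0 →
        (∀ v w, ψ.form (y v) w + ψ.form v (y w) = 0) → (∃ q : ℚ, y * y = q • 1) →
          LinearMap.trace ℂ _ (y.baseChange ℂ * Θ) ≠ 0 := by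
  classical
  intro Θ hΘ y hy hy0 hskew hq htr
  obtain ⟨q, hq⟩ := hq
  haveI : Module.Finite ℚ (bettiCohomology A.X 1) := finite_bettiCohomology_one A
  have hX : IsSmoothProjective A.dim A.X := AbelianVariety.isSmoothProjective_holds
  have heff := BettiUniverse.hodge_isEffective hHD hX 1
  have hΘ' : ∀ p, ∀ x ∈ (BettiUniverse.hodge hHD (AbelianVariety.isSmoothProjective_holds (A := A)) 1).piece p
      (((1 : ℕ) : ℤ) - p), Θ x = ((2 * p - ((1 : ℕ) : ℤ) : ℤ) : ℂ) • x := by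
    simpa using hΘ
  -- (1) `q < 0`
  have hq0 : q < 0 :=
    CMArith.lt_zero_of_skew_of_mul_self (BettiUniverse.hodge hHD (AbelianVariety.isSmoothProjective_holds (A := A)) 1) ψ
      hy hy0 hskew hq
  -- (2) reverse transport: `y = c • F^*`
  obtain ⟨e, he⟩ := (mem_endAlg_hodge_one_iff_exists_bettiRep hHD hI y).1 hy
  obtain ⟨c, F, hF⟩ := exists_unop_bettiRep_eq_smul_pull e
  rw [he] at hF
  have hF' : y = c • (bettiCohomology.map F.hom.hom.hom 1).hom := hF
  have hc : c ≠ 0 := by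
    rintro rfl
    rw [zero_smul] at hF'
    exact hy0 hF'
  have hPy : (bettiCohomology.map F.hom.hom.hom 1).hom = c⁻¹ • y := by
    rw [hF', smul_smul, inv_mul_cancel₀ hc, one_smul]
  have hPP : (bettiCohomology.map F.hom.hom.hom 1).hom * (bettiCohomology.map F.hom.hom.hom 1).hom =
      (c⁻¹ * c⁻¹ * q) • 1 := by
    rw [hPy, smul_mul_smul_comm, hq, smul_smul]
  -- (3) the integers: `r = q / c²`, `β = den(r) • F`, `d = den(r) · |num(r)|`
  set r : ℚ := c⁻¹ * c⁻¹ * q with hrdef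
  have hr0 : r < 0 := mul_neg_of_pos_of_neg (mul_self_pos.2 (inv_ne_zero hc)) hq0
  have hnum : r.num < 0 := Rat.num_neg.2 hr0
  have hN' : r.num = -((r.num.natAbs : ℕ) : ℤ) := by omega
  have hN : (r.num : ℚ) = -((r.num.natAbs : ℕ) : ℚ) := by exact_mod_cast hN'
  have hNpos : 0 < r.num.natAbs := Int.natAbs_pos.2 hnum.ne
  have hd : 0 < r.den * r.num.natAbs := Nat.mul_pos r.den_pos hNpos
  have hPβ : (bettiCohomology.map (r.den • F).hom.hom.hom 1).hom = (r.den : ℚ) • (bettiCohomology.map F.hom.hom.hom 1).hom := by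
    have h := congrArg MulOpposite.unop (map_nsmul (bettiRep₀ A) r.den (CategoryTheory.End.of F))
    rw [MulOpposite.unop_smul, bettiRep₀_apply, bettiRep₀_apply, MulOpposite.unop_op, MulOpposite.unop_op] at h
    rw [Nat.cast_smul_eq_nsmul]
    exact h
  have hββP : (bettiCohomology.map (r.den • F).hom.hom.hom 1).hom * (bettiCohomology.map (r.den • F).hom.hom.hom 1).hom =
      -(((r.den * r.num.natAbs : ℕ) : ℚ) • 1) := by
    rw [hPβ, smul_mul_smul_comm, hPP, smul_smul, Nat.cast_mul, ← neg_smul]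
    congr 1
    calc (r.den : ℚ) * r.den * (c⁻¹ * c⁻¹ * q) = r.den * (r.den * r) := by rw [hrdef]; ring
      _ = r.den * r.num := by rw [Rat.den_mul_eq_num]
      _ = -((r.den : ℚ) * r.num.natAbs) := by rw [hN]; ring
  have hββ : (r.den • F) ≫ (r.den • F) = -((r.den * r.num.natAbs) • 𝟙 A) :=
    comp_self_eq_neg_nsmul_id (r.den • F) _ hββP
  -- (4) the geometric hypothesis
  set s : ℂ := Complex.I * (Real.sqrt ((r.den * r.num.natAbs : ℕ) : ℝ) : ℂ) with hsdef
  have hne := hnW (r.den * r.num.natAbs) (r.den • F) hd hββ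
  rw [← hsdef] at hne
  have hs2 : s * s = -(((r.den * r.num.natAbs : ℕ) : ℂ)) := by
    rw [hsdef, mul_mul_mul_comm, Complex.I_mul_I, ← Complex.ofReal_mul, Real.mul_self_sqrt (Nat.cast_nonneg _),
      Complex.ofReal_natCast, neg_one_mul]
  have hs0 : s ≠ 0 := by
    rw [hsdef]
    refine mul_ne_zero Complex.I_ne_zero ?_
    rw [Ne, Complex.ofReal_eq_zero]
    exact (Real.sqrt_pos.2 (Nat.cast_pos.2 hd)).ne'
  have hconj : starRingEnd ℂ s = -s := by
    rw [hsdef, map_mul, Complex.conj_I, Complex.conj_ofReal, neg_mul]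
  -- (5) `X = β^*`: a rational multiple of `y`, a Hodge endomorphism with `X_ℂ² = s²`
  have hXy : (bettiCohomology.map (r.den • F).hom.hom.hom 1).hom = ((r.den : ℚ) * c⁻¹) • y := by
    rw [hPβ, hPy, smul_smul]
  have hXE : (bettiCohomology.map (r.den • F).hom.hom.hom 1).hom ∈
      (BettiUniverse.hodge hHD (AbelianVariety.isSmoothProjective_holds (A := A)) 1).endAlg := by
    rw [hXy]
    exact Subalgebra.smul_mem _ hy _
  have hXX : ∀ w, (bettiCohomology.map (r.den • F).hom.hom.hom 1).hom.baseChange ℂ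
      ((bettiCohomology.map (r.den • F).hom.hom.hom 1).hom.baseChange ℂ w) = (s * s) • w := fun w => by
    rw [← Module.End.mul_apply, ← LinearMap.baseChange_mul, hββP, hs2, LinearMap.baseChange_neg, LinearMap.neg_apply,
      LinearMap.baseChange_smul, LinearMap.smul_apply, LinearMap.baseChange_one, Module.End.one_apply, neg_smul,
      Nat.cast_smul_eq_nsmul, Nat.cast_smul_eq_nsmul]
  have hΘ𝔤 : Θ ∈ spanC (BettiUniverse.hodge hHD (AbelianVariety.isSmoothProjective_holds (A := A)) 1).hodgeLie :=
    (hodgeLieC_eq_spanC (BettiUniverse.hodge hHD (AbelianVariety.isSmoothProjective_holds (A := A)) 1)) ▸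
      (BettiUniverse.hodge hHD (AbelianVariety.isSmoothProjective_holds (A := A)) 1).mem_hodgeLieC_of_forall_piece hΘ'
  have hΘX : Θ * (bettiCohomology.map (r.den • F).hom.hom.hom 1).hom.baseChange ℂ =
      (bettiCohomology.map (r.den • F).hom.hom.hom 1).hom.baseChange ℂ * Θ :=
    UnitaryTheta.commute_of_mem_spanC (BettiUniverse.hodge hHD (AbelianVariety.isSmoothProjective_holds (A := A)) 1) hXE
      (fun Z hZ a => (BettiUniverse.hodge hHD (AbelianVariety.isSmoothProjective_holds (A := A)) 1).commute_of_mem_hodgeLie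
        hZ a) hΘ𝔤
  -- (6) the trace of `X_ℂ Θ`, twice
  have htrX := CMArith.trace_mul_theta_of_mul_self
    (BettiUniverse.hodge hHD (AbelianVariety.isSmoothProjective_holds (A := A)) 1) Nat.cast_one heff hΘ' hΘX hs0 hXX
  rw [finrank_eigenspace_inf_piece_oneZero_eq_eigenMultiplicity hHD hI (r.den • F) s,
    finrank_eigenspace_inf_piece_zeroOne_eq_eigenMultiplicity_conj hHD hI (r.den • F) s,
    finrank_eigenspace_inf_piece_oneZero_eq_eigenMultiplicity hHD hI (r.den • F) (-s),
    finrank_eigenspace_inf_piece_zeroOne_eq_eigenMultiplicity_conj hHD hI (r.den • F) (-s), map_neg, hconj,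
    neg_neg] at htrX
  have htrX0 : LinearMap.trace ℂ _ ((bettiCohomology.map (r.den • F).hom.hom.hom 1).hom.baseChange ℂ * Θ) = 0 := by
    rw [hXy, LinearMap.baseChange_smul, ← algebraMap_smul ℂ ((r.den : ℚ) * c⁻¹), smul_mul_assoc, map_smul, htr,
      smul_zero]
  rw [htrX0] at htrX
  rcases mul_eq_zero.1 htrX.symm with h | h
  · exact hs0 h
  · have h2 : (2 : ℂ) * ((eigenMultiplicity A (r.den • F) s : ℂ) - eigenMultiplicity A (r.den • F) (-s)) = 0 := by
      rw [← h]; ring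
    have h3 := sub_eq_zero.1 ((mul_eq_zero.1 h2).resolve_left two_ne_zero)
    exact hne (by exact_mod_cast h3)

end Literature.AlgebraicGeometry.HodgeTheory
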